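import Literature.AlgebraicGeometry.Resolution.LinearProjectionZEtale
import Literature.AlgebraicGeometry.Resolution.Lemma411SmoothFibreCriterion
import Literature.AlgebraicGeometry.Resolution.LinearSectionsSingularLocus
import HarnessLib

/-!
# The fibre of the linear projection over `y₀ = (0 : … : 0 : 1)` is smooth (normal case)

Topic: `Literature/AlgebraicGeometry/Resolution`. The pointwise input of
`DeJong1996.smooth_fiberToSpecResidueField_fibration` (`Lemma411SmoothFibreCriterion`) for the
linear projection `π = (t₀ : … : t_{d+1})` of de Jong's Lemma 4.11 (de Jong 1996, p. 68: "By
Bertini's theorem we may choose `π` such that the general fibre of `f` is smooth", the case `X`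
normal): over the closed point `y₀ = (0 : … : 0 : 1) ∈ ℙ^d` the fibre of `pr ∘ π : X° → ℙ^d` is the
curve `C = X ∩ V(t₀, …, t_{d-1})` off the vertex, and `pr ∘ π` is smooth at its closed points as
soon as `𝒪_{X,x}/(t₀, …, t_{d-1})` is regular of dimension `≤ 1` there (conclusion (C5) of
`LinSec.exists_goodForms`):

* `DeJong1996.yZero k d` — the point `y₀` (`vertex (d-1)` for `d ≥ 1`, the point of `ℙ^0` for
  `d = 0`), `isClosed_singleton_yZero`;
* `DeJong1996.offVertexProjection_mem_basicOpen_iff` — `pr(π(x)) ∈ D₊(yⱼ) ↔ π(x) ∈ D₊(xⱼ)`;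
* `LinSec.mem_smoothLocus_offVertexProjection_proj` — **`pr ∘ π` is smooth at every closed point
  of `X°` over `y₀`** (`𝔪_{y₀} = (yₐ/y_d)ₐ`, `DeJong1996.maximalIdeal_stalk_vertex`, pulls back to
  `(tₐ/t_d)ₐ = (t₀, …, t_{d-1})_x`, `LinSec.stalkMap_proj_germ_sec`, and
  `DeJong1996.mem_smoothLocus_offVertexProjection`).

Everything is proved; no named facts.

## References

* A. J. de Jong, *Smoothness, semi-stability and alterations*, Publ. Math. IHÉS 83 (1996),
  proof of Lemma 4.11, p. 68. [DeJong1996]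
* H. Matsumura, *Commutative Ring Theory* (1986), Thm. 23.1. [Matsumura1987]
-/

noncomputable section

open CategoryTheory CategoryTheory.Limits AlgebraicGeometry TopologicalSpace Topology Opposite
  HomogeneousLocalization IsLocalRing
open Literature.AlgebraicGeometry.Morphisms.ProjCech (grading PP)
open Literature.AlgebraicGeometry.Motives
open Literature.AlgebraicGeometry.Motives.RatFn
open Literature.Topology

attribute [local instance] MvPolynomial.gradedAlgebra
  Literature.AlgebraicGeometry.Motives.ProjBaseChange.algebraBase

namespace Literature.AlgebraicGeometry.Resolution

universe u

namespace DeJong1996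

open Literature.AlgebraicGeometry.Motives.Segre (frac toSpec)

variable (k : Type u) [Field k]

/-! ## The point `y₀ ∈ ℙ^d` -/

/-- **The point `y₀ = (0 : … : 0 : 1) ∈ ℙ^d_k`** over which the fibre of the fibration is read:
the vertex of `ℙ^{(d-1)+1}` for `d ≥ 1`, the (unique) point of `ℙ^0` for `d = 0`. [folklore] -/
def yZero : (d : ℕ) → ProjSpace.P d k
  | 0 => genericPoint (ProjSpace.P 0 k)
  | d' + 1 => vertex d' k

/-- `y₀` is a closed point. [folklore] -/
theorem isClosed_singleton_yZero (d : ℕ) : IsClosed ({yZero k d} : Set (ProjSpace.P d k)) := by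
  cases d with
  | zero =>
    -- `ℙ^0` has dimension `0`: all its points are closed
    refine LinSec.isClosed_singleton_of_topologicalKrullDim_lt_one (X := ProjSpace.P 0 k) isClosed_univ ?_
      (Set.mem_univ _)
    rw [IsHomeomorph.topologicalKrullDim_eq _ (Homeomorph.Set.univ (ProjSpace.P 0 k)).isHomeomorph,
      ProjSpace.topologicalKrullDim_eq]
    exact_mod_cast Nat.zero_lt_one
  | succ d' => exact isClosed_singleton_vertex d' k

/-- The maximal ideal of the local ring at the point of `ℙ^0` is zero (that local ring is the
function field). [folklore] -/
theorem maximalIdeal_stalk_eq_bot_of_eq_genericPoint {Y : Scheme.{u}} [IsIntegral Y] {y : Y}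
    (hy : y = genericPoint Y) : maximalIdeal (Y.presheaf.stalk y) = ⊥ := by
  subst hy
  refine IsLocalRing.isField_iff_maximalIdeal_eq.mp ?_
  exact isField_stalk_of_closure_mem_irreducibleComponents Y (genericPoint Y) (by
    rw [genericPoint_closure, irreducibleComponents_eq_singleton]; exact Set.mem_singleton _)

/-- **`𝔪_{vertex} = (yₐ/y_{d+1})ₐ`** written at a point `y = vertex` with the coordinate sections
`ProjSpace.sec` of the last chart (transport of `DeJong1996.maximalIdeal_stalk_vertex`). [folklore] -/
theorem span_germ_sec_eq_maximalIdeal_of_eq_vertex (d : ℕ) {y : ProjSpace.P (d + 1) k} (hy : y = vertex d k)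
    (hyV : y ∈ (ProjSpace.U (Fin.last (d + 1)) : (ProjSpace.P (d + 1) k).Opens)) :
    Ideal.span (Set.range fun a : Fin (d + 1) =>
        (((ProjSpace.P (d + 1) k).presheaf.germ (ProjSpace.U (Fin.last (d + 1))) y hyV).hom
          (ProjSpace.sec (Fin.last (d + 1)) (frac k (Fin.last (d + 1)) (Fin.castSucc a))))) =
      maximalIdeal ((ProjSpace.P (d + 1) k).presheaf.stalk y) := by
  subst hy
  rw [maximalIdeal_stalk_vertex d k]
  have hsec : ∀ a : Fin (d + 1), vertexSection d k a =
      ProjSpace.sec (Fin.last (d + 1)) (frac k (Fin.last (d + 1)) (Fin.castSucc a)) := fun a => by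
    rw [vertexSection_eq, ProjSpace.sec_eq_awayToSection, ← PointBlowup.frac_succAbove_eq_chartGen,
      Fin.succAbove_last_apply]
  congr 1
  ext s
  simp only [Set.mem_range]
  constructor
  · rintro ⟨a, rfl⟩; exact ⟨a, by rw [← hsec a]; rfl⟩
  · rintro ⟨a, rfl⟩; exact ⟨a, by rw [← hsec a]; rfl⟩

/-- `y₀ ∈ D₊(y_d)`. [folklore] -/
theorem yZero_mem_U_last (d : ℕ) : yZero k d ∈ (ProjSpace.U (Fin.last d) : (ProjSpace.P d k).Opens) := by
  cases d with
  | zero => exact ProjSpace.genericPoint_mem_U 0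
  | succ d' => exact vertex_mem_basicOpen_last d' k

/-- `y₀ ∉ D₊(yₐ)` for `a < d`. [folklore] -/
theorem yZero_notMem_U_castSucc (d : ℕ) (a : Fin d) :
    yZero k d ∉ (ProjSpace.U (Fin.castSucc a) : (ProjSpace.P d k).Opens) := by
  cases d with
  | zero => exact a.elim0
  | succ d' => exact vertex_notMem_basicOpen d' k a

/-- **`𝔪_{y₀} = (yₐ/y_d)_{a<d}`** at a point `y = y₀`, with the coordinate sections of the chart
`D₊(y_d)` (for `d = 0` both sides vanish). [folklore] -/
theorem span_germ_sec_eq_maximalIdeal_of_eq_yZero (d : ℕ) {y : ProjSpace.P d k} (hy : y = yZero k d)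
    (hyV : y ∈ (ProjSpace.U (Fin.last d) : (ProjSpace.P d k).Opens)) :
    Ideal.span (Set.range fun a : Fin d =>
        (((ProjSpace.P d k).presheaf.germ (ProjSpace.U (Fin.last d)) y hyV).hom
          (ProjSpace.sec (Fin.last d) (frac k (Fin.last d) (Fin.castSucc a))))) =
      maximalIdeal ((ProjSpace.P d k).presheaf.stalk y) := by
  cases d with
  | zero =>
    rw [Set.range_eq_empty, Ideal.span_empty]
    exact (maximalIdeal_stalk_eq_bot_of_eq_genericPoint hy).symm
  | succ d' => exact span_germ_sec_eq_maximalIdeal_of_eq_vertex k d' hy hyV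

variable {k} (d : ℕ) {X : Scheme.{u}} (π : X ⟶ ProjSpace.P (d + 1) k)

/-- `pr(π(x)) ∈ D₊(yⱼ) ↔ π(x) ∈ D₊(xⱼ)` for `x ∈ X°`, `j ≤ d`. [folklore] -/
theorem offVertexProjection_mem_basicOpen_iff (x : ↥(offVertex d k π)) (j : Fin (d + 1)) :
    offVertexProjection d k π x ∈ (ProjSpace.U j : (ProjSpace.P d k).Opens) ↔
      π ((offVertex d k π).ι x) ∈ (ProjSpace.U (Fin.castSucc j) : (ProjSpace.P (d + 1) k).Opens) := by
  change vertexProjection d k ((π ∣_ puncturedSpace d k) x) ∈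
      Proj.basicOpen (grading k d) (MvPolynomial.X j) ↔ _
  rw [← Scheme.Hom.mem_preimage, vertexProjection_preimage_basicOpen, Scheme.Hom.mem_preimage,
    ← Scheme.Hom.comp_apply, morphismRestrict_ι]
  rfl

end DeJong1996

namespace LinSec

open DeJong1996 BertiniAffine
open Literature.AlgebraicGeometry.Motives.Segre (frac toSpec)

variable {k : Type u} [Field k] [IsAlgClosed k] {N : ℕ} {X : Scheme.{u}} [IsIntegral X]
  [X.Over (Spec (.of k))] (ι : X ⟶ PP k N) [IsClosedImmersion ι] [IsProper (X ↘ Spec (.of k))]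
  {d : ℕ} (hdim : topologicalKrullDim X = (d + 1 : ℕ))
  (t : Fin (d + 1 + 1) → Fin (N + 1) → k) (hbpf : NoCommonZero ι t)

/-- Unit scaling does not change the span of a family. [folklore] -/
theorem _root_.Literature.AlgebraicGeometry.Resolution.PlumbingZEtale.span_range_mul_unit_inv
    {R : Type*} [CommRing R] {m : ℕ} (s : Fin m → R) {u : R} (hu : IsUnit u) :
    Ideal.span (Set.range fun a => s a * ↑hu.unit⁻¹) = Ideal.span (Set.range s) := by
  apply le_antisymm
  · refine Ideal.span_le.mpr ?_
    rintro _ ⟨a, rfl⟩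
    exact Ideal.mul_mem_right _ _ (Ideal.subset_span ⟨a, rfl⟩)
  · refine Ideal.span_le.mpr ?_
    rintro _ ⟨a, rfl⟩
    have : s a = (s a * ↑hu.unit⁻¹) * u := by
      rw [mul_assoc, IsUnit.val_inv_mul, mul_one]
    rw [this]
    exact Ideal.mul_mem_right _ _ (Ideal.subset_span ⟨a, rfl⟩)

/-- `π_t`. -/
local notation "πt" => proj ι t (X ↘ Spec (CommRingCat.of k)) hbpf

omit [IsClosedImmersion ι] in
include hdim in
set_option maxHeartbeats 800000 in
/-- **`pr ∘ π` is smooth at the closed points of `X°` over `y₀`** for the linear projection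
`π = (t₀ : … : t_{d+1})`, as soon as `𝒪_{X,x}/(t₀, …, t_{d-1})` is regular of dimension `≤ 1`
at every closed common zero `x` of `t₀, …, t_{d-1}` (the normal case of de Jong's Lemma 4.11:
`𝔪_{y₀}𝒪_{X,x} = (t₀/t_d, …, t_{d-1}/t_d)_x = (t₀, …, t_{d-1})_x`, and Matsumura 23.1 /
Stacks 01V8 via `DeJong1996.mem_smoothLocus_offVertexProjection`).
[cite: DeJong1996, Lemma 4.11 (proof), p. 68] [cite: Matsumura1987, Thm. 23.1] -/
theorem mem_smoothLocus_offVertexProjection_proj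
    (hC5 : ∀ x : X, IsClosed ({x} : Set X) → x ∈ cutSet ι (Fin.take d (Nat.le_add_right d 2) t) →
      IsRegularLocalRing (X.presheaf.stalk x ⧸ cutIdeal ι x (Fin.take d (Nat.le_add_right d 2) t)) ∧
      ringKrullDim (X.presheaf.stalk x ⧸ cutIdeal ι x (Fin.take d (Nat.le_add_right d 2) t)) ≤ 1)
    [LocallyOfFinitePresentation (offVertexProjection d k (proj ι t (X ↘ Spec (.of k)) hbpf))]
    (x : ↥(offVertex d k (proj ι t (X ↘ Spec (.of k)) hbpf)))
    (hxc : IsClosed ({(offVertex d k (proj ι t (X ↘ Spec (.of k)) hbpf)).ι x} : Set X))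
    (hy : offVertexProjection d k (proj ι t (X ↘ Spec (.of k)) hbpf) x = yZero k d) :
    x ∈ (offVertexProjection d k (proj ι t (X ↘ Spec (.of k)) hbpf)).smoothLocus := by
  have hyc : IsClosed ({offVertexProjection d k (πt) x} : Set (ProjSpace.P d k)) := by
    rw [hy]; exact isClosed_singleton_yZero k d
  -- `y₀ ∈ D₊(y_d) ∖ ⋃_{a<d} D₊(y_a)`: so `t_d(x) ≠ 0` and `t_a(x) = 0` for `a < d`
  have hyV : offVertexProjection d k (πt) x ∈ (ProjSpace.U (Fin.last d) : (ProjSpace.P d k).Opens) := by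
    rw [hy]; exact yZero_mem_U_last k d
  have hxP : (πt) ((offVertex d k (πt)).ι x) ∈
      (ProjSpace.U (Fin.castSucc (Fin.last d)) : (ProjSpace.P (d + 1) k).Opens) :=
    (offVertexProjection_mem_basicOpen_iff d (πt) x _).mp hyV
  have hxd : (offVertex d k (πt)).ι x ∉ hyp ι (t (Fin.castSucc (Fin.last d))) :=
    (proj_apply_mem_basicOpen_iff ι t _ hbpf _ _).mp hxP
  have hxa : ∀ a : Fin d, (offVertex d k (πt)).ι x ∈ hyp ι (t (Fin.castSucc (Fin.castSucc a))) := by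
    intro a
    by_contra hna
    have h1 : (πt) ((offVertex d k (πt)).ι x) ∈
        (ProjSpace.U (Fin.castSucc (Fin.castSucc a)) : (ProjSpace.P (d + 1) k).Opens) :=
      (proj_apply_mem_basicOpen_iff ι t _ hbpf _ _).mpr hna
    have h2 := (offVertexProjection_mem_basicOpen_iff d (πt) x (Fin.castSucc a)).mpr h1
    rw [hy] at h2
    exact yZero_notMem_U_castSucc k d a h2
  have hxcut : (offVertex d k (πt)).ι x ∈ cutSet ι (Fin.take d (Nat.le_add_right d 2) t) :=
    Set.mem_iInter.mpr fun a => hxa a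
  obtain ⟨hreg, hdim1⟩ := hC5 _ hxc hxcut
  -- the generators: `γₐ = yₐ/y_d` at `y₀`, `gₐ = π^*(xₐ/x_d) = tₐ/t_d` at `x`
  obtain ⟨h, hxh⟩ := exists_mem_chart ι ((offVertex d k (πt)).ι x)
  have hxU : (offVertex d k (πt)).ι x ∈ lsChart (formVec ι t) (Fin.castSucc (Fin.last d)) :=
    mem_lsChart_of_notMem_hyp ι hxd
  set s : Fin d → X.presheaf.stalk ((offVertex d k (πt)).ι x) := fun a =>
    (X.presheaf.germ (chart ι h) _ hxh).hom (linSec ι h (t (Fin.castSucc (Fin.castSucc a)))) with hs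
  have hu : IsUnit ((X.presheaf.germ (chart ι h) _ hxh).hom (linSec ι h (t (Fin.castSucc (Fin.last d))))) := by
    have := (mem_hyp_iff_not_isUnit_germ ι hxh (t (Fin.castSucc (Fin.last d)))).not.mp hxd
    rwa [not_not] at this
  have hratio : ∀ a : Fin d, ratioGerm d (πt) hxP (Fin.castSucc a) = s a * ↑hu.unit⁻¹ := by
    intro a
    have h1 : ratioGerm d (πt) hxP (Fin.castSucc a) = (X.presheaf.germ _ _ hxU).hom
        (lsRatio (formVec ι t) (Fin.castSucc (Fin.last d)) (Fin.castSucc (Fin.castSucc a))) :=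
      stalkMap_proj_germ_sec ι t _ hbpf (Fin.castSucc (Fin.last d)) hxP hxU (Fin.castSucc (Fin.castSucc a))
    have h2 := germ_lsRatio_mul_germ_linSec ι t hxh hxU (Fin.castSucc (Fin.castSucc a))
    rw [h1]
    refine (Units.eq_mul_inv_iff_mul_eq (c := hu.unit)).mpr ?_
    rw [IsUnit.unit_spec]
    exact h2
  have hspan : Ideal.span (Set.range fun a : Fin d => ratioGerm d (πt) hxP (Fin.castSucc a)) =
      cutIdeal ι ((offVertex d k (πt)).ι x) (Fin.take d (Nat.le_add_right d 2) t) := by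
    rw [show (fun a : Fin d => ratioGerm d (πt) hxP (Fin.castSucc a)) = fun a => s a * ↑hu.unit⁻¹
      from funext hratio, PlumbingZEtale.span_range_mul_unit_inv s hu, cutIdeal_eq_span_of_mem ι _ _ hxh, hs]
    rfl
  rw [← hspan] at hreg hdim1
  exact mem_smoothLocus_offVertexProjection d (πt) (X ↘ Spec (.of k)) hdim x hxc hyc
    (fun a : Fin d => (((ProjSpace.P d k).presheaf.germ (ProjSpace.U (Fin.last d)) _ hyV).hom
      (ProjSpace.sec (Fin.last d) (frac k (Fin.last d) (Fin.castSucc a)))))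
    (span_germ_sec_eq_maximalIdeal_of_eq_yZero k d hy hyV)
    (fun a => ratioGerm d (πt) hxP (Fin.castSucc a))
    (fun a => stalkMap_offVertexProjection_germ_sec d (πt) x (Fin.last d) (Fin.castSucc a) hyV hxP)
    hreg hdim1

end LinSec

end Literature.AlgebraicGeometry.Resolution

end
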